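import Summits.Ventures.Crystal3D.Theorems.StickyWulffConstantGenericWallFloorBarlowRowOrientedGlue
import Summits.Ventures.Crystal3D.Theorems.StickyWulffConstantGenericWallFloorBarlowRowRowLineCountM
import Summits.Ventures.Crystal3D.Theorems.StickyWulffConstantGenericWallFloorBarlowZigZigOrientedGlue36
import Summits.Ventures.Crystal3D.Theorems.StickyWulffConstantGenericWallFloorBarlowCoverableGlue
import Summits.Ventures.Crystal3D.Theorems.StickyWulffConstantTextureLiminfTexShadowCornerFramesDefs
import Summits.Ventures.Crystal3D.Theorems.StickyWulffConstantTextureLiminfLineCountGlueRowStrip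
import HarnessLib

/-!
# Lane T's v3 `hlines` for `OffR := BarlowPairOffReach`: the four corners assembled (`barlow_rowhlines`)
# (crux `GenericWallFloor`, stmt-Ventures-19480, line `WallLedgerG`; closes lane T's `stub_bilayerWallRowCov` by
# `bilayerWallRowCovFrom_of_lineCounts BarlowPairOffReach 6 _ barlow_rowhlines`, modulo E1 / StarPairFar carried as hypotheses)

HONEST FRAMING. Venture `Summits/Ventures/Crystal3D` (cell `crystal3d-full`), helper `--supports` the crux `GenericWallFloor`
(stmt-Ventures-19480) of `route-Ventures-StickyWulffConstant`, registered line `WallLedgerG`, open stub `stub_twoSlabAdhesion`.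
Rung credit only; F-C1 not moved; NOT the stub.  Inputs BY NAME: E1 (`hsE`, `hcert`), `DoubleStarCoaxialAt` / `CapPairCoaxial`
(`hDS`, `hCP`, from `StarPairFar`).

Per plate the corner is lane T's `ZigGood` (zigzags, weight `zigW = 1`) or not (rows on the `++` c-layers, `rowW = 1`); the paid
families are counted by `barlow_hlines_oriented36` (zig|zig), `barlow_rowZig_hlines_oriented`, `barlow_zigRow_hlines_oriented`,
`barlow_rowRow_hlines`, zig plates being UP-PRESENTED first (`exists_upPresentation`, selectors transported back as in
`barlow_hlines_coverable`); the unpaid (weight `0`) families only need finite supersets of their window sets —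
`exists_selector_lineSets` (some selector + line sets through any finite set of plate balls) and `exists_rowSets`.
* **`barlow_rowhlines`** — for every pair with `BarlowPairOffReach`: selectors `step₁ step₂` and, per cell, `m ≥ 0`, `T₁ … T₄ ⊇` the
  four window sets at `ρ − m`, `zigW₁·#T₁ + zigW₂·#T₂ + rowW₁·#T₃ + rowW₂·#T₄ + 36mρ ≤ Σ_PAY(12−deg) + (540 + 384R₀)(1+h)ρ`.
* **`bilayerWallRowCovFrom_barlowPairOffReach`** — lane T's row-covered part `BilayerWallRowCovFrom BarlowPairOffReach 6`, i.e.
  `bilayerWallRowCovFrom_of_lineCounts` fed with `barlow_rowhlines` (`C_w := 540 + 384 R₀`), modulo E1 / `StarPairFar` as hypotheses.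
WHAT THIS IS NOT: not the stub; the option-(C) `FramesApart` version is lane G's next build; F-C1 not moved.
-/

noncomputable section

namespace Summit.Ventures.Crystal3D.Theorems

open Finset
open Literature.MathematicalPhysics.StatisticalMechanics (barlowPos barlowStacking barlowLayer basalMirror haggLabel barlowOffset
  IsHaggSeq triangularVec₁ triangularVec₂)
open Summit.Ventures.Crystal3D.Cruxes.TextureLiminf.TexShadow (stacking cyl upSlot₁ upSlot₂ upSlot₃ bilayerRise upFrame upWord famSlot
  DeltaSteep ZigGood zigW rowW IsCLayer BarlowPairOffReach BilayerWallRowCovFrom bestLayerDir layerRise RowSteep stacking_upFrame upFrame_axis_nonneg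
  isHaggSeq_upWord famSlot_steep_of_deltaSteep cornerReach_of_zigGood cornerReach_of_not_zigGood rowSteep_of_not_zigGood inner_bestLayerDir)
open scoped InnerProductSpace

/-- **Some selector, with finite line sets through any finite set of plate balls** (the weight-`0` zig family). -/
theorem exists_selector_lineSets (L : EuclideanSpace ℝ (Fin 3) ≃ₗᵢ[ℝ] EuclideanSpace ℝ (Fin 3)) {σ : ℤ → ℤ} (hσ : IsHaggSeq σ)
    (s e : EuclideanSpace ℝ (Fin 3)) :
    ∃ step : ℤ → EuclideanSpace ℝ (Fin 3), IsZigSelector L σ e step ∧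
      ∀ W : Finset (EuclideanSpace ℝ (Fin 3)), (∀ q ∈ W, q ∈ stacking L s σ) →
        ∃ Tl : Finset (Fin 2 → ℤ), ∀ t : Fin 2 → ℤ,
          (∃ k : ℤ, L (zigVertexS step k + ((t 0 : ℝ) • triangularVec₁ 1 + (t 1 : ℝ) • triangularVec₂ 1)) + s ∈ W) → t ∈ Tl := by
  classical
  obtain ⟨hσ', hax, hst, htr⟩ := exists_upPresentation L hσ s e
  set L' := upFrame L e with hL'
  set σ' := upWord L σ e with hσ'def
  set V := best3 (fun w => ⟪w, L'.symm e⟫_ℝ) upSlot₁ upSlot₂ upSlot₃ with hV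
  set q := bestCapper (twinFrame L' (L' (EuclideanSpace.single (2 : Fin 3) (1 : ℝ)))) (L' (EuclideanSpace.single (2 : Fin 3) (1 : ℝ))) e
    with hq
  set ms : ℤ → EuclideanSpace ℝ (Fin 3) := fun m => if σ' m = 1 then V else basalMirror q with hms
  have hne : ¬ ((-1 : ℤ) = 1) := by decide
  have hms₁ : ∀ m, σ' m = 1 → ms m = V := fun m hm => by simp only [hms, hm, if_true]
  have hms₂ : ∀ m, σ' m = -1 → ms m = basalMirror q := fun m hm => by simp only [hms, hm, hne, if_false]
  set step' : ℤ → EuclideanSpace ℝ (Fin 3) := fun k => ms (zigSlab L' e k) with hstep'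
  have hsel' : IsZigSelector L' σ' e step' := isZigSelector_machineStep σ' L' e V ms hσ' hax hV hms₁ hms₂
  have hlayer' : ∀ k, zigVertexS step' k ∈ barlowLayer 1 (Real.sqrt (2 / 3)) σ' k := fun k => by
    have := zigVertexS_mem_barlowLayer L' hσ' e hsel' k
    unfold zigLayer at this; rwa [if_pos hax] at this
  obtain ⟨step, hsel, hpt⟩ := htr step' hsel'
  refine ⟨step, hsel, fun W hW => ?_⟩
  have hWsite : ∀ p ∈ W, ∃ k i j : ℤ, p = L' (barlowPos 1 (Real.sqrt (2 / 3)) σ' k i j) + s := by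
    intro p hp
    have hp' : p ∈ stacking L' s σ' := by rw [hst]; exact hW p hp
    obtain ⟨r, ⟨k, i, j, rfl⟩, hr⟩ := hp'
    exact ⟨k, i, j, hr.symm⟩
  obtain ⟨Tl, hTlin, -, -⟩ := lineSet_of_sites σ' L' s (zigVertexS step') hlayer' W hWsite
  exact ⟨Tl, fun t ⟨k, hk⟩ => hTlin t ⟨k, by rw [← hpt k t]; exact hk⟩⟩

/-- **Finite row sets through any finite set of plate balls** (the weight-`0` row family). -/
theorem exists_rowSets (σ : ℤ → ℤ) (L : EuclideanSpace ℝ (Fin 3) ≃ₗᵢ[ℝ] EuclideanSpace ℝ (Fin 3)) (s z : EuclideanSpace ℝ (Fin 3))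
    (W : Finset (EuclideanSpace ℝ (Fin 3))) (hW : ∀ q ∈ W, q ∈ stacking L s σ) :
    ∃ Tr : Finset (ℤ × ℤ), ∀ kj : ℤ × ℤ, (∃ i : ℤ, L (layerSite σ L z kj.1 i kj.2) + s ∈ W) → kj ∈ Tr := by
  classical
  obtain ⟨a₀, b₀, a₁, b₁, hdet, hw, hw'⟩ := exists_rowCoeffs L z
  have hWsite : ∀ p ∈ W, ∃ k x y : ℤ, p = L (barlowPos 1 (Real.sqrt (2 / 3)) σ k x y) + s := by
    intro p hp
    obtain ⟨r, ⟨k, i, j, rfl⟩, hr⟩ := hW p hp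
    exact ⟨k, i, j, hr.symm⟩
  obtain ⟨Tr, hTrin, -, -⟩ := rowSet_of_sites σ L s z hdet hw hw' W hWsite
  exact ⟨Tr, hTrin⟩

/-- Moved polyline points of a selector (plus in-plane lattice vectors) are plate sites. -/
theorem selector_point_mem_stacking (L : EuclideanSpace ℝ (Fin 3) ≃ₗᵢ[ℝ] EuclideanSpace ℝ (Fin 3)) {σ : ℤ → ℤ} (hσ : IsHaggSeq σ)
    (s e : EuclideanSpace ℝ (Fin 3)) {step : ℤ → EuclideanSpace ℝ (Fin 3)} (hsel : IsZigSelector L σ e step) (k : ℤ) (t : Fin 2 → ℤ) :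
    L (zigVertexS step k + ((t 0 : ℝ) • triangularVec₁ 1 + (t 1 : ℝ) • triangularVec₂ 1)) + s ∈ stacking L s σ := by
  obtain ⟨x, y, hxy⟩ := zigVertexS_mem_barlowLayer L hσ e hsel k
  refine ⟨_, ⟨zigLayer L e k, x + t 0, y + t 1, ?_⟩, rfl⟩
  rw [hxy, barlowPos_add_inplane]

open scoped Classical in
/-- **Lane T's v3 `hlines` for `OffR := BarlowPairOffReach`.**  See the module docstring. -/
theorem barlow_rowhlines
    {sE : EuclideanSpace ℝ (Fin 3)} (hsE : sE ∈ fccSlots) (hcert : ExactOnly 0 (fccSlots.filter fun w => 0 < ⟪w, sE⟫_ℝ))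
    (hDS : ∀ F₁ F₂ : EuclideanSpace ℝ (Fin 3) ≃ₗᵢ[ℝ] EuclideanSpace ℝ (Fin 3), DoubleStarCoaxialAt F₁ F₂) (hCP : CapPairCoaxial)
    (R₀ : ℝ) (hR₀ : 6 ≤ R₀) {σ₁ σ₂ : ℤ → ℤ} (hσ₁ : IsHaggSeq σ₁) (hσ₂ : IsHaggSeq σ₂)
    (L₁ L₂ : EuclideanSpace ℝ (Fin 3) ≃ₗᵢ[ℝ] EuclideanSpace ℝ (Fin 3)) (s₁ s₂ : EuclideanSpace ℝ (Fin 3))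
    (hoff : BarlowPairOffReach L₁ s₁ σ₁ L₂ s₂ σ₂) :
    ∃ step₁ step₂ : ℤ → EuclideanSpace ℝ (Fin 3),
      IsZigSelector L₁ σ₁ (EuclideanSpace.single (2 : Fin 3) (1 : ℝ)) step₁ ∧
      IsZigSelector L₂ σ₂ (-EuclideanSpace.single (2 : Fin 3) (1 : ℝ)) step₂ ∧
      ∀ h : ℝ, 0 ≤ h → ∀ ρ : ℝ, R₀ ≤ ρ → ∀ X P₁ P₂ : Finset (EuclideanSpace ℝ (Fin 3)),
      (∀ p ∈ X, ∀ q ∈ X, p ≠ q → 1 ≤ dist p q) → P₁ ⊆ X → P₂ ⊆ X \ P₁ → (∀ p ∈ X, p ∈ cyl R₀ h ρ) →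
      (∀ p, p ∈ P₁ ↔ (p ∈ stacking L₁ s₁ σ₁ ∧ -(2 * R₀) ≤ p 2 ∧ p 2 ≤ -R₀ ∧ p 0 ^ 2 + p 1 ^ 2 ≤ ρ ^ 2)) →
      (∀ p, p ∈ P₂ ↔ (p ∈ stacking L₂ s₂ σ₂ ∧ h + R₀ ≤ p 2 ∧ p 2 ≤ h + 2 * R₀ ∧ p 0 ^ 2 + p 1 ^ 2 ≤ ρ ^ 2)) →
      ∃ (m : ℝ) (T₁ T₂ : Finset (Fin 2 → ℤ)) (T₃ T₄ : Finset (ℤ × ℤ)), 0 ≤ m ∧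
        (∀ t : Fin 2 → ℤ, (∃ k : ℤ,
          -R₀ - 4 ≤ (L₁ (zigVertexS step₁ k + ((t 0 : ℝ) • triangularVec₁ 1 + (t 1 : ℝ) • triangularVec₂ 1)) + s₁) 2 ∧
          (L₁ (zigVertexS step₁ k + ((t 0 : ℝ) • triangularVec₁ 1 + (t 1 : ℝ) • triangularVec₂ 1)) + s₁) 2 ≤ -R₀ - 3 ∧
          Real.sqrt ((L₁ (zigVertexS step₁ k + ((t 0 : ℝ) • triangularVec₁ 1 + (t 1 : ℝ) • triangularVec₂ 1)) + s₁) 0 ^ 2 +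
            (L₁ (zigVertexS step₁ k + ((t 0 : ℝ) • triangularVec₁ 1 + (t 1 : ℝ) • triangularVec₂ 1)) + s₁) 1 ^ 2) ≤ ρ - m) →
          t ∈ T₁) ∧
        (∀ t : Fin 2 → ℤ, (∃ k : ℤ,
          h + R₀ + 3 ≤ (L₂ (zigVertexS step₂ k + ((t 0 : ℝ) • triangularVec₁ 1 + (t 1 : ℝ) • triangularVec₂ 1)) + s₂) 2 ∧
          (L₂ (zigVertexS step₂ k + ((t 0 : ℝ) • triangularVec₁ 1 + (t 1 : ℝ) • triangularVec₂ 1)) + s₂) 2 ≤ h + R₀ + 4 ∧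
          Real.sqrt ((L₂ (zigVertexS step₂ k + ((t 0 : ℝ) • triangularVec₁ 1 + (t 1 : ℝ) • triangularVec₂ 1)) + s₂) 0 ^ 2 +
            (L₂ (zigVertexS step₂ k + ((t 0 : ℝ) • triangularVec₁ 1 + (t 1 : ℝ) • triangularVec₂ 1)) + s₂) 1 ^ 2) ≤ ρ - m) →
          t ∈ T₂) ∧
        (∀ kj : ℤ × ℤ, IsCLayer σ₁ kj.1 → (∃ i : ℤ,
          -R₀ - 4 ≤ (L₁ (layerSite σ₁ L₁ (EuclideanSpace.single (2 : Fin 3) (1 : ℝ)) kj.1 i kj.2) + s₁) 2 ∧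
          (L₁ (layerSite σ₁ L₁ (EuclideanSpace.single (2 : Fin 3) (1 : ℝ)) kj.1 i kj.2) + s₁) 2 ≤ -R₀ - 3 ∧
          Real.sqrt ((L₁ (layerSite σ₁ L₁ (EuclideanSpace.single (2 : Fin 3) (1 : ℝ)) kj.1 i kj.2) + s₁) 0 ^ 2 +
            (L₁ (layerSite σ₁ L₁ (EuclideanSpace.single (2 : Fin 3) (1 : ℝ)) kj.1 i kj.2) + s₁) 1 ^ 2) ≤ ρ - m) → kj ∈ T₃) ∧
        (∀ kj : ℤ × ℤ, IsCLayer σ₂ kj.1 → (∃ i : ℤ,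
          h + R₀ + 3 ≤ (L₂ (layerSite σ₂ L₂ (-EuclideanSpace.single (2 : Fin 3) (1 : ℝ)) kj.1 i kj.2) + s₂) 2 ∧
          (L₂ (layerSite σ₂ L₂ (-EuclideanSpace.single (2 : Fin 3) (1 : ℝ)) kj.1 i kj.2) + s₂) 2 ≤ h + R₀ + 4 ∧
          Real.sqrt ((L₂ (layerSite σ₂ L₂ (-EuclideanSpace.single (2 : Fin 3) (1 : ℝ)) kj.1 i kj.2) + s₂) 0 ^ 2 +
            (L₂ (layerSite σ₂ L₂ (-EuclideanSpace.single (2 : Fin 3) (1 : ℝ)) kj.1 i kj.2) + s₂) 1 ^ 2) ≤ ρ - m) → kj ∈ T₄) ∧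
        zigW L₁ σ₁ (EuclideanSpace.single (2 : Fin 3) (1 : ℝ)) * (T₁.card : ℝ) +
            zigW L₂ σ₂ (-EuclideanSpace.single (2 : Fin 3) (1 : ℝ)) * T₂.card +
            rowW L₁ σ₁ (EuclideanSpace.single (2 : Fin 3) (1 : ℝ)) * T₃.card +
            rowW L₂ σ₂ (-EuclideanSpace.single (2 : Fin 3) (1 : ℝ)) * T₄.card + 36 * m * ρ ≤
          (∑ y ∈ X.filter (fun y => (X.filter fun q => dist y q = 1).card ≠ 12 ∧ -R₀ - 2 ≤ y 2 ∧ y 2 ≤ h + R₀ + 2),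
            ((12 : ℝ) - ((X.filter fun q => dist y q = 1).card : ℝ))) + (540 + 384 * R₀) * (1 + h) * ρ := by
  set e₃ : EuclideanSpace ℝ (Fin 3) := EuclideanSpace.single (2 : Fin 3) (1 : ℝ) with he₃
  have he₃n : ‖e₃‖ = 1 := by rw [he₃, PiLp.norm_single, norm_one]
  have hztn : ‖-e₃‖ = 1 := by rw [norm_neg, he₃n]
  have he₃' : Summit.Ventures.Crystal3D.Cruxes.TextureLiminf.TexShadow.e₃ = e₃ := rfl
  -- the two up-presentations (used by the zig families)
  obtain ⟨hσ₁', hax₁, hst₁, htr₁⟩ := exists_upPresentation L₁ hσ₁ s₁ e₃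
  obtain ⟨hσ₂', hax₂, hst₂, htr₂⟩ := exists_upPresentation L₂ hσ₂ s₂ (-e₃)
  set L₁' := upFrame L₁ e₃ with hL₁'
  set L₂' := upFrame L₂ (-e₃) with hL₂'
  set σ₁' := upWord L₁ σ₁ e₃ with hσ₁'def
  set σ₂' := upWord L₂ σ₂ (-e₃) with hσ₂'def
  have hfam₁ : famSlot L₁ e₃ = best3 (fun w => ⟪w, L₁'.symm e₃⟫_ℝ) upSlot₁ upSlot₂ upSlot₃ := rfl
  have hfam₂ : famSlot L₂ (-e₃) = best3 (fun w => ⟪w, L₂'.symm (-e₃)⟫_ℝ) upSlot₁ upSlot₂ upSlot₃ := rfl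
  -- weight-0 providers
  obtain ⟨stepZ₁, hselZ₁, hlinesZ₁⟩ := exists_selector_lineSets L₁ hσ₁ s₁ e₃
  obtain ⟨stepZ₂, hselZ₂, hlinesZ₂⟩ := exists_selector_lineSets L₂ hσ₂ s₂ (-e₃)
  -- row steepness from ¬ZigGood
  have hrow_of : ∀ (L : EuclideanSpace ℝ (Fin 3) ≃ₗᵢ[ℝ] EuclideanSpace ℝ (Fin 3)) (σ : ℤ → ℤ) (z : EuclideanSpace ℝ (Fin 3)),
      ‖z‖ = 1 → ¬ ZigGood L σ z → Real.sqrt 2 / 2 ≤ ⟪L (bestLayerDir L z), z⟫_ℝ := by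
    intro L σ z hz h
    have hRS : RowSteep L z := rowSteep_of_not_zigGood hz h
    rw [inner_map_eq_inner_symm, inner_bestLayerDir]; exact hRS
  obtain ⟨hO1, hO2, hO3⟩ := hoff
  rw [he₃'] at hO1 hO2 hO3
  -- generic ⊇ proofs for weight-0 families, per cell
  have rowSup₁ : ∀ (h ρ m : ℝ) (X P₁ : Finset (EuclideanSpace ℝ (Fin 3))), 0 ≤ m → R₀ ≤ ρ →
      (∀ p, p ∈ P₁ ↔ (p ∈ stacking L₁ s₁ σ₁ ∧ -(2 * R₀) ≤ p 2 ∧ p 2 ≤ -R₀ ∧ p 0 ^ 2 + p 1 ^ 2 ≤ ρ ^ 2)) →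
      ∃ T₃ : Finset (ℤ × ℤ), ∀ kj : ℤ × ℤ, IsCLayer σ₁ kj.1 → (∃ i : ℤ,
          -R₀ - 4 ≤ (L₁ (layerSite σ₁ L₁ e₃ kj.1 i kj.2) + s₁) 2 ∧ (L₁ (layerSite σ₁ L₁ e₃ kj.1 i kj.2) + s₁) 2 ≤ -R₀ - 3 ∧
          Real.sqrt ((L₁ (layerSite σ₁ L₁ e₃ kj.1 i kj.2) + s₁) 0 ^ 2 + (L₁ (layerSite σ₁ L₁ e₃ kj.1 i kj.2) + s₁) 1 ^ 2) ≤ ρ - m) →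
        kj ∈ T₃ := by
    intro h ρ m X P₁ hm0 hρ hP₁
    obtain ⟨Tr, hTr⟩ := exists_rowSets σ₁ L₁ s₁ e₃ P₁ (fun q hq => ((hP₁ q).1 hq).1)
    refine ⟨Tr, fun kj _ ⟨i, h1, h2, h3⟩ => hTr kj ⟨i, (hP₁ _).2 ⟨layerSite_mem_stacking σ₁ L₁ e₃ s₁ kj.1 i kj.2,
      by linarith only [h1, hR₀], by linarith only [h2], ?_⟩⟩⟩
    have h0 : 0 ≤ (L₁ (layerSite σ₁ L₁ e₃ kj.1 i kj.2) + s₁) 0 ^ 2 + (L₁ (layerSite σ₁ L₁ e₃ kj.1 i kj.2) + s₁) 1 ^ 2 := by positivity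
    have hle : Real.sqrt ((L₁ (layerSite σ₁ L₁ e₃ kj.1 i kj.2) + s₁) 0 ^ 2 + (L₁ (layerSite σ₁ L₁ e₃ kj.1 i kj.2) + s₁) 1 ^ 2) ≤ ρ := by
      linarith only [h3, hm0]
    have h7 := pow_le_pow_left₀ (Real.sqrt_nonneg _) hle 2
    rwa [Real.sq_sqrt h0] at h7
  have rowSup₂ : ∀ (h ρ m : ℝ) (X P₂ : Finset (EuclideanSpace ℝ (Fin 3))), 0 ≤ m → R₀ ≤ ρ →
      (∀ p, p ∈ P₂ ↔ (p ∈ stacking L₂ s₂ σ₂ ∧ h + R₀ ≤ p 2 ∧ p 2 ≤ h + 2 * R₀ ∧ p 0 ^ 2 + p 1 ^ 2 ≤ ρ ^ 2)) →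
      ∃ T₄ : Finset (ℤ × ℤ), ∀ kj : ℤ × ℤ, IsCLayer σ₂ kj.1 → (∃ i : ℤ,
          h + R₀ + 3 ≤ (L₂ (layerSite σ₂ L₂ (-e₃) kj.1 i kj.2) + s₂) 2 ∧ (L₂ (layerSite σ₂ L₂ (-e₃) kj.1 i kj.2) + s₂) 2 ≤ h + R₀ + 4 ∧
          Real.sqrt ((L₂ (layerSite σ₂ L₂ (-e₃) kj.1 i kj.2) + s₂) 0 ^ 2 + (L₂ (layerSite σ₂ L₂ (-e₃) kj.1 i kj.2) + s₂) 1 ^ 2) ≤ ρ - m) →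
        kj ∈ T₄ := by
    intro h ρ m X P₂ hm0 hρ hP₂
    obtain ⟨Tr, hTr⟩ := exists_rowSets σ₂ L₂ s₂ (-e₃) P₂ (fun q hq => ((hP₂ q).1 hq).1)
    refine ⟨Tr, fun kj _ ⟨i, h1, h2, h3⟩ => hTr kj ⟨i, (hP₂ _).2 ⟨layerSite_mem_stacking σ₂ L₂ (-e₃) s₂ kj.1 i kj.2,
      by linarith only [h1], by linarith only [h2, hR₀], ?_⟩⟩⟩
    have h0 : 0 ≤ (L₂ (layerSite σ₂ L₂ (-e₃) kj.1 i kj.2) + s₂) 0 ^ 2 + (L₂ (layerSite σ₂ L₂ (-e₃) kj.1 i kj.2) + s₂) 1 ^ 2 := by positivity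
    have hle : Real.sqrt ((L₂ (layerSite σ₂ L₂ (-e₃) kj.1 i kj.2) + s₂) 0 ^ 2 + (L₂ (layerSite σ₂ L₂ (-e₃) kj.1 i kj.2) + s₂) 1 ^ 2) ≤ ρ := by
      linarith only [h3, hm0]
    have h7 := pow_le_pow_left₀ (Real.sqrt_nonneg _) hle 2
    rwa [Real.sq_sqrt h0] at h7
  have zigSup₁ : ∀ (h ρ m : ℝ) (X P₁ : Finset (EuclideanSpace ℝ (Fin 3))), 0 ≤ m → R₀ ≤ ρ →
      (∀ p, p ∈ P₁ ↔ (p ∈ stacking L₁ s₁ σ₁ ∧ -(2 * R₀) ≤ p 2 ∧ p 2 ≤ -R₀ ∧ p 0 ^ 2 + p 1 ^ 2 ≤ ρ ^ 2)) →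
      ∃ T₁ : Finset (Fin 2 → ℤ), ∀ t : Fin 2 → ℤ, (∃ k : ℤ,
          -R₀ - 4 ≤ (L₁ (zigVertexS stepZ₁ k + ((t 0 : ℝ) • triangularVec₁ 1 + (t 1 : ℝ) • triangularVec₂ 1)) + s₁) 2 ∧
          (L₁ (zigVertexS stepZ₁ k + ((t 0 : ℝ) • triangularVec₁ 1 + (t 1 : ℝ) • triangularVec₂ 1)) + s₁) 2 ≤ -R₀ - 3 ∧
          Real.sqrt ((L₁ (zigVertexS stepZ₁ k + ((t 0 : ℝ) • triangularVec₁ 1 + (t 1 : ℝ) • triangularVec₂ 1)) + s₁) 0 ^ 2 +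
            (L₁ (zigVertexS stepZ₁ k + ((t 0 : ℝ) • triangularVec₁ 1 + (t 1 : ℝ) • triangularVec₂ 1)) + s₁) 1 ^ 2) ≤ ρ - m) → t ∈ T₁ := by
    intro h ρ m X P₁ hm0 hρ hP₁
    obtain ⟨Tl, hTl⟩ := hlinesZ₁ P₁ (fun q hq => ((hP₁ q).1 hq).1)
    refine ⟨Tl, fun t ⟨k, h1, h2, h3⟩ => hTl t ⟨k, (hP₁ _).2 ⟨?_, by linarith only [h1, hR₀], by linarith only [h2], ?_⟩⟩⟩
    · exact selector_point_mem_stacking L₁ hσ₁ s₁ e₃ hselZ₁ k t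
    · set q := L₁ (zigVertexS stepZ₁ k + ((t 0 : ℝ) • triangularVec₁ 1 + (t 1 : ℝ) • triangularVec₂ 1)) + s₁
      have h0 : 0 ≤ q 0 ^ 2 + q 1 ^ 2 := by positivity
      have hle : Real.sqrt (q 0 ^ 2 + q 1 ^ 2) ≤ ρ := by linarith only [h3, hm0]
      have h7 := pow_le_pow_left₀ (Real.sqrt_nonneg _) hle 2
      rwa [Real.sq_sqrt h0] at h7
  have zigSup₂ : ∀ (h ρ m : ℝ) (X P₂ : Finset (EuclideanSpace ℝ (Fin 3))), 0 ≤ m → R₀ ≤ ρ →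
      (∀ p, p ∈ P₂ ↔ (p ∈ stacking L₂ s₂ σ₂ ∧ h + R₀ ≤ p 2 ∧ p 2 ≤ h + 2 * R₀ ∧ p 0 ^ 2 + p 1 ^ 2 ≤ ρ ^ 2)) →
      ∃ T₂ : Finset (Fin 2 → ℤ), ∀ t : Fin 2 → ℤ, (∃ k : ℤ,
          h + R₀ + 3 ≤ (L₂ (zigVertexS stepZ₂ k + ((t 0 : ℝ) • triangularVec₁ 1 + (t 1 : ℝ) • triangularVec₂ 1)) + s₂) 2 ∧
          (L₂ (zigVertexS stepZ₂ k + ((t 0 : ℝ) • triangularVec₁ 1 + (t 1 : ℝ) • triangularVec₂ 1)) + s₂) 2 ≤ h + R₀ + 4 ∧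
          Real.sqrt ((L₂ (zigVertexS stepZ₂ k + ((t 0 : ℝ) • triangularVec₁ 1 + (t 1 : ℝ) • triangularVec₂ 1)) + s₂) 0 ^ 2 +
            (L₂ (zigVertexS stepZ₂ k + ((t 0 : ℝ) • triangularVec₁ 1 + (t 1 : ℝ) • triangularVec₂ 1)) + s₂) 1 ^ 2) ≤ ρ - m) → t ∈ T₂ := by
    intro h ρ m X P₂ hm0 hρ hP₂
    obtain ⟨Tl, hTl⟩ := hlinesZ₂ P₂ (fun q hq => ((hP₂ q).1 hq).1)
    refine ⟨Tl, fun t ⟨k, h1, h2, h3⟩ => hTl t ⟨k, (hP₂ _).2 ⟨?_, by linarith only [h1], by linarith only [h2, hR₀], ?_⟩⟩⟩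
    · exact selector_point_mem_stacking L₂ hσ₂ s₂ (-e₃) hselZ₂ k t
    · set q := L₂ (zigVertexS stepZ₂ k + ((t 0 : ℝ) • triangularVec₁ 1 + (t 1 : ℝ) • triangularVec₂ 1)) + s₂
      have h0 : 0 ≤ q 0 ^ 2 + q 1 ^ 2 := by positivity
      have hle : Real.sqrt (q 0 ^ 2 + q 1 ^ 2) ≤ ρ := by linarith only [h3, hm0]
      have h7 := pow_le_pow_left₀ (Real.sqrt_nonneg _) hle 2
      rwa [Real.sq_sqrt h0] at h7
  by_cases hZ₁ : ZigGood L₁ σ₁ e₃ <;> by_cases hZ₂ : ZigGood L₂ σ₂ (-e₃)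
  · -- ZIG | ZIG
    rw [cornerReach_of_zigGood hZ₁ s₁] at hO1 hO3
    rw [cornerReach_of_zigGood hZ₂ s₂] at hO2 hO3
    rw [hfam₁] at hO1 hO3; rw [hfam₂] at hO2 hO3
    have hst1 := famSlot_steep_of_deltaSteep L₁ e₃ hZ₁.1
    have hst2 := famSlot_steep_of_deltaSteep L₂ (-e₃) hZ₂.1
    rw [hfam₁] at hst1; rw [hfam₂] at hst2
    obtain ⟨step₁', step₂', hsel₁', hsel₂', hmain⟩ := barlow_hlines_oriented36 hsE hcert hDS hCP hσ₁' hσ₂' L₁' L₂' s₁ s₂ hax₁ hax₂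
      hst1 hst2 (fun y hy => by rw [hst₂]; exact hO1 y hy) (fun y hy => by rw [hst₁]; exact hO2 y hy) hO3 R₀ hR₀
    obtain ⟨step₁, hsel₁, hpt₁⟩ := htr₁ step₁' hsel₁'
    obtain ⟨step₂, hsel₂, hpt₂⟩ := htr₂ step₂' hsel₂'
    refine ⟨step₁, step₂, hsel₁, hsel₂, ?_⟩
    intro h hh ρ hρ X P₁ P₂ hX hP₁X hP₂X hcyl hP₁ hP₂
    have hP₁' : ∀ p, p ∈ P₁ ↔ (p ∈ stacking L₁' s₁ σ₁' ∧ -(2 * R₀) ≤ p 2 ∧ p 2 ≤ -R₀ ∧ p 0 ^ 2 + p 1 ^ 2 ≤ ρ ^ 2) := by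
      intro p; rw [hst₁]; exact hP₁ p
    have hP₂' : ∀ p, p ∈ P₂ ↔ (p ∈ stacking L₂' s₂ σ₂' ∧ h + R₀ ≤ p 2 ∧ p 2 ≤ h + 2 * R₀ ∧ p 0 ^ 2 + p 1 ^ 2 ≤ ρ ^ 2) := by
      intro p; rw [hst₂]; exact hP₂ p
    obtain ⟨m, T₁, T₂, hm0, hT₁, hT₂, hcount⟩ := hmain h hh ρ hρ X P₁ P₂ hX hP₁X hP₂X hcyl hP₁' hP₂'
    obtain ⟨T₃, hT₃⟩ := rowSup₁ h ρ m X P₁ hm0 hρ hP₁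
    obtain ⟨T₄, hT₄⟩ := rowSup₂ h ρ m X P₂ hm0 hρ hP₂
    refine ⟨m, T₁, T₂, T₃, T₄, hm0, fun t ⟨k, hk⟩ => hT₁ t ⟨k, ?_⟩, fun t ⟨k, hk⟩ => hT₂ t ⟨k, ?_⟩, hT₃, hT₄, ?_⟩
    · rw [← hpt₁ k t]; exact hk
    · rw [← hpt₂ k t]; exact hk
    · simp only [zigW, rowW, if_pos hZ₁, if_pos hZ₂]
      have h0 : (0 : ℝ) ≤ T₃.card := Nat.cast_nonneg _
      linarith
  · -- ZIG | ROW
    rw [cornerReach_of_zigGood hZ₁ s₁] at hO1 hO3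
    rw [cornerReach_of_not_zigGood hZ₂ s₂] at hO2 hO3
    rw [hfam₁] at hO1 hO3
    have hst1 := famSlot_steep_of_deltaSteep L₁ e₃ hZ₁.1
    rw [hfam₁] at hst1
    have hrow₂ := hrow_of L₂ σ₂ (-e₃) hztn hZ₂
    obtain ⟨step₁', hsel₁', hmain⟩ := barlow_zigRow_hlines_oriented hsE hcert hDS hCP hσ₁' hσ₂ L₁' L₂ s₁ s₂ hax₁ hst1 hrow₂
      hO1 (fun y hy => by rw [hst₁]; exact hO2 y hy) hO3 R₀ hR₀
    obtain ⟨step₁, hsel₁, hpt₁⟩ := htr₁ step₁' hsel₁'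
    refine ⟨step₁, stepZ₂, hsel₁, hselZ₂, ?_⟩
    intro h hh ρ hρ X P₁ P₂ hX hP₁X hP₂X hcyl hP₁ hP₂
    have hP₁' : ∀ p, p ∈ P₁ ↔ (p ∈ stacking L₁' s₁ σ₁' ∧ -(2 * R₀) ≤ p 2 ∧ p 2 ≤ -R₀ ∧ p 0 ^ 2 + p 1 ^ 2 ≤ ρ ^ 2) := by
      intro p; rw [hst₁]; exact hP₁ p
    obtain ⟨m, T₁, T₄, hm0, hT₁, hT₄, hcount⟩ := hmain h hh ρ hρ X P₁ P₂ hX hP₁X hP₂X hcyl hP₁' hP₂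
    obtain ⟨T₂, hT₂⟩ := zigSup₂ h ρ m X P₂ hm0 hρ hP₂
    obtain ⟨T₃, hT₃⟩ := rowSup₁ h ρ m X P₁ hm0 hρ hP₁
    refine ⟨m, T₁, T₂, T₃, T₄, hm0, fun t ⟨k, hk⟩ => hT₁ t ⟨k, ?_⟩, hT₂, hT₃, fun kj hc hi => hT₄ kj ⟨hc, hi⟩, ?_⟩
    · rw [← hpt₁ k t]; exact hk
    · simp only [zigW, rowW, if_pos hZ₁, if_neg hZ₂]
      have h0 : (0 : ℝ) ≤ T₂.card := Nat.cast_nonneg _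
      have h0' : (0 : ℝ) ≤ T₃.card := Nat.cast_nonneg _
      linarith
  · -- ROW | ZIG
    rw [cornerReach_of_not_zigGood hZ₁ s₁] at hO1 hO3
    rw [cornerReach_of_zigGood hZ₂ s₂] at hO2 hO3
    rw [hfam₂] at hO2 hO3
    have hst2 := famSlot_steep_of_deltaSteep L₂ (-e₃) hZ₂.1
    rw [hfam₂] at hst2
    have hrow₁ := hrow_of L₁ σ₁ e₃ he₃n hZ₁
    obtain ⟨step₂', hsel₂', hmain⟩ := barlow_rowZig_hlines_oriented hsE hcert hDS hCP hσ₁ hσ₂' L₁ L₂' s₁ s₂ hrow₁ hax₂ hst2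
      (fun y hy => by rw [hst₂]; exact hO1 y hy) hO2 hO3 R₀ hR₀
    obtain ⟨step₂, hsel₂, hpt₂⟩ := htr₂ step₂' hsel₂'
    refine ⟨stepZ₁, step₂, hselZ₁, hsel₂, ?_⟩
    intro h hh ρ hρ X P₁ P₂ hX hP₁X hP₂X hcyl hP₁ hP₂
    have hP₂' : ∀ p, p ∈ P₂ ↔ (p ∈ stacking L₂' s₂ σ₂' ∧ h + R₀ ≤ p 2 ∧ p 2 ≤ h + 2 * R₀ ∧ p 0 ^ 2 + p 1 ^ 2 ≤ ρ ^ 2) := by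
      intro p; rw [hst₂]; exact hP₂ p
    obtain ⟨m, T₃, T₂, hm0, hT₃, hT₂, hcount⟩ := hmain h hh ρ hρ X P₁ P₂ hX hP₁X hP₂X hcyl hP₁ hP₂'
    obtain ⟨T₁, hT₁⟩ := zigSup₁ h ρ m X P₁ hm0 hρ hP₁
    obtain ⟨T₄, hT₄⟩ := rowSup₂ h ρ m X P₂ hm0 hρ hP₂
    refine ⟨m, T₁, T₂, T₃, T₄, hm0, hT₁, fun t ⟨k, hk⟩ => hT₂ t ⟨k, ?_⟩, fun kj hc hi => hT₃ kj ⟨hc, hi⟩, hT₄, ?_⟩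
    · rw [← hpt₂ k t]; exact hk
    · simp only [zigW, rowW, if_neg hZ₁, if_pos hZ₂]
      have h0 : (0 : ℝ) ≤ T₁.card := Nat.cast_nonneg _
      have h0' : (0 : ℝ) ≤ T₄.card := Nat.cast_nonneg _
      linarith
  · -- ROW | ROW
    rw [cornerReach_of_not_zigGood hZ₁ s₁] at hO1 hO3
    rw [cornerReach_of_not_zigGood hZ₂ s₂] at hO2 hO3
    have hrow₁ := hrow_of L₁ σ₁ e₃ he₃n hZ₁
    have hrow₂ := hrow_of L₂ σ₂ (-e₃) hztn hZ₂
    have hmain := barlow_rowRow_hlines hsE hcert hDS hCP hσ₁ hσ₂ L₁ L₂ s₁ s₂ hrow₁ hrow₂ hO1 hO2 hO3 R₀ hR₀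
    refine ⟨stepZ₁, stepZ₂, hselZ₁, hselZ₂, ?_⟩
    intro h hh ρ hρ X P₁ P₂ hX hP₁X hP₂X hcyl hP₁ hP₂
    obtain ⟨m, T₃, T₄, hm0, hT₃, hT₄, hcount⟩ := hmain h hh ρ hρ X P₁ P₂ hX hP₁X hP₂X hcyl hP₁ hP₂
    obtain ⟨T₁, hT₁⟩ := zigSup₁ h ρ m X P₁ hm0 hρ hP₁
    obtain ⟨T₂, hT₂⟩ := zigSup₂ h ρ m X P₂ hm0 hρ hP₂
    refine ⟨m, T₁, T₂, T₃, T₄, hm0, hT₁, hT₂, fun kj hc hi => hT₃ kj ⟨hc, hi⟩, fun kj hc hi => hT₄ kj ⟨hc, hi⟩, ?_⟩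
    simp only [zigW, rowW, if_neg hZ₁, if_neg hZ₂]
    have h0 : (0 : ℝ) ≤ T₁.card := Nat.cast_nonneg _
    have h0' : (0 : ℝ) ≤ T₂.card := Nat.cast_nonneg _
    linarith

/-- **Lane T's row-covered part from thickness `6` for `OffR := BarlowPairOffReach`**, from E1 (`hsE`, `hcert`) and the
`StarPairFar` facts (`hDS`, `hCP`): `bilayerWallRowCovFrom_of_lineCounts` fed with `barlow_rowhlines` (`C_w := 540 + 384 R₀`). -/
theorem bilayerWallRowCovFrom_barlowPairOffReach
    {sE : EuclideanSpace ℝ (Fin 3)} (hsE : sE ∈ fccSlots) (hcert : ExactOnly 0 (fccSlots.filter fun w => 0 < ⟪w, sE⟫_ℝ))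
    (hDS : ∀ F₁ F₂ : EuclideanSpace ℝ (Fin 3) ≃ₗᵢ[ℝ] EuclideanSpace ℝ (Fin 3), DoubleStarCoaxialAt F₁ F₂) (hCP : CapPairCoaxial) :
    BilayerWallRowCovFrom BarlowPairOffReach 6 :=
  bilayerWallRowCovFrom_of_lineCounts BarlowPairOffReach 6 (by norm_num) fun R₀ hR₀ =>
    ⟨540 + 384 * R₀, fun _ _ hσ₁ hσ₂ L₁ L₂ s₁ s₂ hoff => barlow_rowhlines hsE hcert hDS hCP R₀ hR₀ hσ₁ hσ₂ L₁ L₂ s₁ s₂ hoff⟩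

end Summit.Ventures.Crystal3D.Theorems

end
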